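import Summits.Ventures.PercRepro.ProfilePointedCircuitClassesStarSharpD0H

/-!
# PercRepro — CASE D0 OF `StarNineSharp`, PART I: RULES R2 / R4a AND THE ASSEMBLY OF THE «NO ON LINE» REGIME
WITH AN ON PLANE THROUGH `e, f` (p5, gen 54; `proofs/P5-GM1.md` §81 (c))

`d0_injR24`: the demands of kinds R2 (off `H`, complement OFF) and R4a (in `H`, the triple `{w₀} ∪ π` usable) inject
together into the bi-bases `W′ ⊆ E₇` containing `e, f` (an R2 image equal to an R4a image would make the
complementary pair of the latter an ON demand, against `d0c4`).  **`inCount_thru_le_of_no_on_line_with_H`** then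
adds the five injections (D0A's OFF map, `d0_injR1`, `d0_injR3`, `d0_injR4b`, `d0_injR24`) against the five
disjoint target kinds: the `b′`-avoiding two-point inequality of `StarNineSharp` holds in the no-ON-line regime
whenever an ON plane through `e, f` exists (the complementary case is D0C).
-/

open scoped Matroid

namespace PercRepro.Cogirth

open Finset ThmH Skew Shadow Profile

open Classical

variable {α : Type} [DecidableEq α] {N : Matroid α} [N.Finite]

section StarSharpD0I

variable {b b' : α}

/-- **RULES R2 AND R4a.** -/
theorem d0_injR24 (hn : (gr N).card = 9) (hR : rk N (gr N) = 5)
    (_hcf : ∀ x ∈ gr N, rk N ((gr N).erase x) = 5) (h : SeriesPair N b b')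
    {e f : α} (he : e ∈ gr N) (hf : f ∈ gr N) (hef : e ≠ f) (heb : e ≠ b) (heb' : e ≠ b') (hfb : f ≠ b) (hfb' : f ≠ b')
    (hE7 : rk N (((gr N).erase b).erase b') = 4)
    (hnl : ∀ S : Finset α, S ⊆ ((gr N).erase b).erase b' → rk N (insert b (insert b' S)) ≤ 3 → rk N S ≤ 1)
    (_he1 : ∀ y ∈ ((((gr N).erase b).erase b').erase f).erase e, rk N {e, y} = 2)
    (_hf1 : ∀ y ∈ ((((gr N).erase b).erase b').erase f).erase e, rk N {f, y} = 2)
    (hef2 : rk N {e, f} = 2) (_hX : rk N (((((gr N).erase b).erase b').erase f).erase e) = 4)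
    {H : Finset α} (hH : H ⊆ ((gr N).erase b).erase b') (heH : e ∈ H) (hfH : f ∈ H) (hH3 : rk N H = 3)
    (hHon : rk N (insert b (insert b' H)) = 4)
    (hHfl : ∀ z ∈ ((gr N).erase b).erase b', z ∉ H → rk N (insert z H) = 4)
    {w₀ : α} (hw₀ : w₀ ∈ ((((gr N).erase b).erase b').erase f).erase e) (hw₀H : w₀ ∉ H) :
    ((d0DON N b' e f).filter (fun W => d0c1 N b e f W ∧ d0c2 N b b' e f W)).card +
      ((d0DON N b' e f).filter (fun W => (¬ d0c1 N b e f W ∧ ¬ d0c3 N b b' e f W) ∧ d0c4 N b b' e f w₀ W)).card ≤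
      ((biIndepSets N 4).filter (fun W => (f ∈ W ∧ b' ∉ W) ∧ (e ∈ W ∧ b ∉ W))).card := by
  classical
  have hb : b ∈ gr N := h.1; have hb' : b' ∈ gr N := h.2.1; have hbb' : b ≠ b' := h.2.2.1
  have hXE : ((((gr N).erase b).erase b').erase f).erase e ⊆ ((gr N).erase b).erase b' :=
    (erase_subset _ _).trans (erase_subset _ _)
  have heE : e ∈ ((gr N).erase b).erase b' := mem_erase.2 ⟨heb', mem_erase.2 ⟨heb, he⟩⟩
  have hfE : f ∈ ((gr N).erase b).erase b' := mem_erase.2 ⟨hfb', mem_erase.2 ⟨hfb, hf⟩⟩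
  have hE7c : (((gr N).erase b).erase b').card = 7 := by
    rw [card_erase_of_mem (mem_erase.2 ⟨hbb'.symm, hb'⟩), card_erase_of_mem hb, hn]
  have hXc : (((((gr N).erase b).erase b').erase f).erase e).card = 5 := by
    rw [card_erase_of_mem (mem_erase.2 ⟨hef, heE⟩), card_erase_of_mem hfE, hE7c]
  have heX : e ∉ ((((gr N).erase b).erase b').erase f).erase e := fun h' => (mem_erase.1 h').1 rfl
  have hfX : f ∉ ((((gr N).erase b).erase b').erase f).erase e := fun h' => (mem_erase.1 (mem_erase.1 h').2).1 rfl
  have hw₀E : w₀ ∈ ((gr N).erase b).erase b' := hXE hw₀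
  have hdata := d0_demand_data h hn hf hef heb hfb hfb' (e := e)
  have hclass := d0_demand_class h hR hE7 hnl he hf hef heb heb' hfb hfb' hef2 hH heH hfH hH3 hHon hHfl
  have hS3 := d0_S3 h hn he hf hef heb heb' hfb hfb'
  set X := ((((gr N).erase b).erase b').erase f).erase e with hXdef
  have hw₀π : ∀ π : Finset α, insert e π ⊆ H → w₀ ∉ π := fun π hπH h' => hw₀H (hπH (mem_insert_of_mem h'))
  have hdisj24 : Disjoint ((d0DON N b' e f).filter (fun W => d0c1 N b e f W ∧ d0c2 N b b' e f W))
      ((d0DON N b' e f).filter (fun W => (¬ d0c1 N b e f W ∧ ¬ d0c3 N b b' e f W) ∧ d0c4 N b b' e f w₀ W)) := by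
    rw [disjoint_filter]
    rintro W _ ⟨h1, -⟩ ⟨⟨h2, -⟩, -⟩
    exact h2 h1
  rw [← card_union_of_disjoint hdisj24]
  apply card_le_card_of_injOn (fun W => if rk N (insert f (insert e ((W.erase b).erase e))) = 4 then
    insert f (W.erase b) else insert f (insert e ((X \ (W.erase b).erase e).erase w₀)))
  · intro W hW
    simp only [d0DON, mem_coe, mem_union, mem_filter] at hW
    have hWD : W ∈ biIndepSets N 4 ∧ ((e ∈ W ∧ f ∉ W) ∧ b' ∉ W) ∧ ¬ (gr N \ W).erase b' ∈ biIndepSets N 4 := by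
      rcases hW with hW | hW <;> exact hW.1
    obtain ⟨hWs, hPD, hcW⟩ := hWD
    obtain ⟨hbW, hπX, hπ2, hYeq, hWeq, hYr, hYc, hYon⟩ := hdata W hWs hPD hcW
    have hfπ : f ∉ (W.erase b).erase e := fun h' => hfX (hπX h')
    have heπ : e ∉ (W.erase b).erase e := fun h' => heX (hπX h')
    simp only [mem_coe, mem_filter]
    split_ifs with hc₁
    · -- R2
      have hc₂ : d0c2 N b b' e f W := by
        rcases hW with hW | hW
        · exact hW.2.2
        · exact absurd hc₁ hW.2.1.1
      have hWE : insert f (W.erase b) ⊆ ((gr N).erase b).erase b' := by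
        rw [← hYeq]; exact insert_subset hfE (insert_subset heE (hπX.trans hXE))
      have hW4 : (insert f (W.erase b)).card = 4 := by
        rw [← hYeq, card_insert_of_notMem, card_insert_of_notMem heπ, hπ2]
        simp only [mem_insert, not_or]; exact ⟨hef.symm, hfπ⟩
      refine ⟨?_, ⟨mem_insert_self _ _, ?_⟩, mem_insert_of_mem (mem_erase.2 ⟨heb, hPD.1.1⟩), ?_⟩
      · rw [mem_biIndepSets_iff_of_subset_E7 h hn hWE hW4, ← hYeq, E7_sdiff_insert_ef_eq]
        exact ⟨hc₁, hc₂⟩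
      · intro h'
        rcases mem_insert.1 h' with h2 | h2
        · exact hfb' h2.symm
        · exact hPD.2 (mem_of_mem_erase h2)
      · intro h'
        rcases mem_insert.1 h' with h2 | h2
        · exact hfb h2.symm
        · exact (mem_erase.1 h2).1 rfl
    · -- R4a
      have hc₄ : d0c4 N b b' e f w₀ W := by
        rcases hW with hW | hW
        · exact absurd hW.2.1 hc₁
        · exact hW.2.2
      obtain ⟨hfY3, hπH⟩ := hclass _ hπX hπ2 hYr hYon hc₁
      have hw₀π' := hw₀π _ hπH
      have hw₀S : w₀ ∈ X \ (W.erase b).erase e := mem_sdiff.2 ⟨hw₀, hw₀π'⟩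
      have hρE : (X \ (W.erase b).erase e).erase w₀ ⊆ X := (erase_subset _ _).trans sdiff_subset
      have hWE : insert f (insert e ((X \ (W.erase b).erase e).erase w₀)) ⊆ ((gr N).erase b).erase b' :=
        insert_subset hfE (insert_subset heE (hρE.trans hXE))
      have hW4 : (insert f (insert e ((X \ (W.erase b).erase e).erase w₀))).card = 4 := by
        rw [card_insert_of_notMem, card_insert_of_notMem (fun h' => heX (hρE h')), card_erase_of_mem hw₀S,
          card_sdiff_of_subset hπX, hXc, hπ2]
        intro h'
        rcases mem_insert.1 h' with h2 | h2
        · exact hef h2.symm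
        · exact hfX (hρE h2)
      obtain ⟨-, htoff⟩ := triple_off h hR hnl hH hH3 hHfl hπX hπ2 hπH hYr hYon hw₀ hw₀H
      refine ⟨?_, ⟨mem_insert_self _ _, ?_⟩, mem_insert_of_mem (mem_insert_self _ _), ?_⟩
      · rw [mem_biIndepSets_iff_of_subset_E7 h hn hWE hW4, E7_sdiff_insert_ef_eq,
          sdiff_sdiff_erase_eq hπX hw₀ hw₀π']
        exact ⟨hc₄.1, htoff⟩
      · intro h'
        rcases mem_insert.1 h' with h2 | h2
        · exact hfb' h2.symm
        · rcases mem_insert.1 h2 with h3 | h3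
          · exact heb' h3.symm
          · exact (mem_erase.1 (hXE (hρE h3))).1 rfl
      · intro h'
        rcases mem_insert.1 h' with h2 | h2
        · exact hfb h2.symm
        · rcases mem_insert.1 h2 with h3 | h3
          · exact heb h3.symm
          · exact (mem_erase.1 (mem_erase.1 (hXE (hρE h3))).2).1 rfl
  · intro W₁ hW₁ W₂ hW₂ heq
    simp only [d0DON, mem_coe, mem_union, mem_filter] at hW₁ hW₂
    have hWD₁ : W₁ ∈ biIndepSets N 4 ∧ ((e ∈ W₁ ∧ f ∉ W₁) ∧ b' ∉ W₁) ∧ ¬ (gr N \ W₁).erase b' ∈ biIndepSets N 4 := by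
      rcases hW₁ with hW | hW <;> exact hW.1
    have hWD₂ : W₂ ∈ biIndepSets N 4 ∧ ((e ∈ W₂ ∧ f ∉ W₂) ∧ b' ∉ W₂) ∧ ¬ (gr N \ W₂).erase b' ∈ biIndepSets N 4 := by
      rcases hW₂ with hW | hW <;> exact hW.1
    obtain ⟨hb₁, hπ₁, hπ2₁, hYeq₁, hWeq₁, hYr₁, hYc₁, hYon₁⟩ := hdata W₁ hWD₁.1 hWD₁.2.1 hWD₁.2.2
    obtain ⟨hb₂, hπ₂, hπ2₂, hYeq₂, hWeq₂, hYr₂, hYc₂, hYon₂⟩ := hdata W₂ hWD₂.1 hWD₂.2.1 hWD₂.2.2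
    have hf₁ : f ∉ W₁.erase b := fun h' => hWD₁.2.1.1.2 (mem_of_mem_erase h')
    have hf₂ : f ∉ W₂.erase b := fun h' => hWD₂.2.1.1.2 (mem_of_mem_erase h')
    simp only at heq
    -- the mixed case: an R2 demand equal to the complementary pair of an R4a demand
    have hmixed : ∀ Wa Wb : Finset α, Wa ∈ biIndepSets N 4 → ((e ∈ Wa ∧ f ∉ Wa) ∧ b' ∉ Wa) →
        ¬ (gr N \ Wa).erase b' ∈ biIndepSets N 4 → (Wb.erase b).erase e ⊆ X → ((Wb.erase b).erase e).card = 2 →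
        rk N (insert e ((Wb.erase b).erase e)) = 3 → rk N (insert b (insert b' (insert e ((Wb.erase b).erase e)))) = 4 →
        ¬ rk N (insert f (insert e ((Wb.erase b).erase e))) = 4 → d0c4 N b b' e f w₀ Wb →
        insert f (Wa.erase b) = insert f (insert e ((X \ (Wb.erase b).erase e).erase w₀)) → False := by
      intro Wa Wb hWas hPDa hcWa hπb hπ2b hYrb hYonb hnc₁b hc₄b heq'
      obtain ⟨hba, -, -, hYeqa, hWeqa, -, -, hYona⟩ := hdata Wa hWas hPDa hcWa
      have hfa : f ∉ Wa.erase b := fun h' => hPDa.1.2 (mem_of_mem_erase h')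
      obtain ⟨-, hπHb⟩ := hclass _ hπb hπ2b hYrb hYonb hnc₁b
      have hfρb : f ∉ insert e ((X \ (Wb.erase b).erase e).erase w₀) := fun h' =>
        (mem_insert.1 h').elim (fun h2 => hef h2.symm) (fun h2 => hfX (mem_sdiff.1 (mem_of_mem_erase h2)).1)
      have e1 : Wa.erase b = insert e ((X \ (Wb.erase b).erase e).erase w₀) := by
        rw [← erase_insert hfa, ← erase_insert hfρb, heq']
      apply hc₄b.2
      refine ⟨?_, ?_⟩
      · rw [← e1, insert_erase hba]; exact hWas
      · rw [← e1, ← hYeqa]; exact hYona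
    split_ifs at heq with h₁ h₂ h₂
    · have e2 : W₁.erase b = W₂.erase b := by
        rw [← erase_insert hf₁, ← erase_insert hf₂, heq]
      rw [← insert_erase hb₁, ← insert_erase hb₂, e2]
    · exfalso
      have hc₄₂ : d0c4 N b b' e f w₀ W₂ := by
        rcases hW₂ with hW | hW
        · exact absurd hW.2.1 h₂
        · exact hW.2.2
      exact hmixed W₁ W₂ hWD₁.1 hWD₁.2.1 hWD₁.2.2 hπ₂ hπ2₂ hYr₂ hYon₂ h₂ hc₄₂ heq
    · exfalso
      have hc₄₁ : d0c4 N b b' e f w₀ W₁ := by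
        rcases hW₁ with hW | hW
        · exact absurd hW.2.1 h₁
        · exact hW.2.2
      exact hmixed W₂ W₁ hWD₂.1 hWD₂.2.1 hWD₂.2.2 hπ₁ hπ2₁ hYr₁ hYon₁ h₁ hc₄₁ heq.symm
    · -- both R4a: the complementary pairs coincide
      obtain ⟨-, hπH₁⟩ := hclass _ hπ₁ hπ2₁ hYr₁ hYon₁ h₁
      obtain ⟨-, hπH₂⟩ := hclass _ hπ₂ hπ2₂ hYr₂ hYon₂ h₂
      have hfρ₁ : f ∉ insert e ((X \ (W₁.erase b).erase e).erase w₀) := fun h' =>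
        (mem_insert.1 h').elim (fun h2 => hef h2.symm) (fun h2 => hfX (mem_sdiff.1 (mem_of_mem_erase h2)).1)
      have hfρ₂ : f ∉ insert e ((X \ (W₂.erase b).erase e).erase w₀) := fun h' =>
        (mem_insert.1 h').elim (fun h2 => hef h2.symm) (fun h2 => hfX (mem_sdiff.1 (mem_of_mem_erase h2)).1)
      have heρ : ∀ π : Finset α, e ∉ (X \ π).erase w₀ := fun π h' => heX (mem_sdiff.1 (mem_of_mem_erase h')).1
      have e3 : (X \ (W₁.erase b).erase e).erase w₀ = (X \ (W₂.erase b).erase e).erase w₀ := by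
        have h1 : insert e ((X \ (W₁.erase b).erase e).erase w₀) = insert e ((X \ (W₂.erase b).erase e).erase w₀) := by
          rw [← erase_insert hfρ₁, ← erase_insert hfρ₂, heq]
        rw [← erase_insert (heρ _), ← erase_insert (heρ ((W₂.erase b).erase e)), h1]
      have hw₀₁ : w₀ ∈ X \ (W₁.erase b).erase e := mem_sdiff.2 ⟨hw₀, hw₀π _ hπH₁⟩
      have hw₀₂ : w₀ ∈ X \ (W₂.erase b).erase e := mem_sdiff.2 ⟨hw₀, hw₀π _ hπH₂⟩
      have e4 : X \ (W₁.erase b).erase e = X \ (W₂.erase b).erase e := by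
        rw [← insert_erase hw₀₁, ← insert_erase hw₀₂, e3]
      have e5 : (W₁.erase b).erase e = (W₂.erase b).erase e := by
        rw [← Finset.sdiff_sdiff_eq_self hπ₁, ← Finset.sdiff_sdiff_eq_self hπ₂, e4]
      rw [← hWeq₁, ← hWeq₂, ← hYeq₁, ← hYeq₂, e5]

/-- **THE NO-ON-LINE REGIME WITH AN ON PLANE THROUGH `e, f`.** -/
theorem inCount_thru_le_of_no_on_line_with_H (hn : (gr N).card = 9) (hR : rk N (gr N) = 5)
    (hcf : ∀ x ∈ gr N, rk N ((gr N).erase x) = 5) (h : SeriesPair N b b')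
    {e f : α} (he : e ∈ gr N) (hf : f ∈ gr N) (hef : e ≠ f) (heb : e ≠ b) (heb' : e ≠ b') (hfb : f ≠ b) (hfb' : f ≠ b')
    (hE7 : rk N (((gr N).erase b).erase b') = 4)
    (hnl : ∀ S : Finset α, S ⊆ ((gr N).erase b).erase b' → rk N (insert b (insert b' S)) ≤ 3 → rk N S ≤ 1)
    (he1 : ∀ y ∈ ((((gr N).erase b).erase b').erase f).erase e, rk N {e, y} = 2)
    (hf1 : ∀ y ∈ ((((gr N).erase b).erase b').erase f).erase e, rk N {f, y} = 2)
    (hef2 : rk N {e, f} = 2) (hX : rk N (((((gr N).erase b).erase b').erase f).erase e) = 4)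
    {H : Finset α} (hH : H ⊆ ((gr N).erase b).erase b') (heH : e ∈ H) (hfH : f ∈ H) (hH3 : rk N H = 3)
    (hHon : rk N (insert b (insert b' H)) = 4)
    (hHfl : ∀ z ∈ ((gr N).erase b).erase b', z ∉ H → rk N (insert z H) = 4) :
    inCount N 4 e + thruCount N 4 {b', f} + thruCount N 4 {b', e, f} ≤
      inCount N 4 f + thruCount N 4 {e, f} + thruCount N 4 {b', e} := by
  classical
  rw [inCount_thru_split']
  have heX : e ∉ ((((gr N).erase b).erase b').erase f).erase e := fun h' => (mem_erase.1 h').1 rfl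
  have hfX : f ∉ ((((gr N).erase b).erase b').erase f).erase e := fun h' => (mem_erase.1 (mem_erase.1 h').2).1 rfl
  have hE7c : (((gr N).erase b).erase b').card = 7 := by
    rw [card_erase_of_mem (mem_erase.2 ⟨h.2.2.1.symm, h.2.1⟩), card_erase_of_mem h.1, hn]
  have hXc : (((((gr N).erase b).erase b').erase f).erase e).card = 5 := by
    rw [card_erase_of_mem (mem_erase.2 ⟨hef, mem_erase.2 ⟨heb', mem_erase.2 ⟨heb, he⟩⟩⟩),
      card_erase_of_mem (mem_erase.2 ⟨hfb', mem_erase.2 ⟨hfb, hf⟩⟩), hE7c]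
  -- a point `w₀ ∈ X ∖ H`
  obtain ⟨w₀, hw₀, hw₀H⟩ : ∃ w₀ ∈ ((((gr N).erase b).erase b').erase f).erase e, w₀ ∉ H := by
    by_contra hall
    push Not at hall
    have hsub : ((((gr N).erase b).erase b').erase f).erase e ⊆ (H.erase e).erase f := by
      intro x hx
      exact mem_erase.2 ⟨fun h' => hfX (h' ▸ hx), mem_erase.2 ⟨fun h' => heX (h' ▸ hx), hall x hx⟩⟩
    have h1 := card_le_card hsub
    have h2 := card_H_le_five h hn hcf hE7 hH hH3 hHon
    rw [hXc, card_erase_of_mem (mem_erase.2 ⟨hef.symm, hfH⟩), card_erase_of_mem heH] at h1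
    omega
  set X := ((((gr N).erase b).erase b').erase f).erase e with hXdef
  -- the OFF / ON split of the demands
  have hsplit := card_filter_add_card_filter_not (s := (biIndepSets N 4).filter (fun W => (e ∈ W ∧ f ∉ W) ∧ b' ∉ W))
    (fun W => (gr N \ W).erase b' ∈ biIndepSets N 4)
  simp only [filter_filter] at hsplit
  -- the five target kinds
  have htar : ((biIndepSets N 4).filter (fun W => (f ∈ W ∧ b' ∉ W) ∧ (e ∉ W ∧ (gr N \ W).erase b' ∈ biIndepSets N 4))).card +
      ((biIndepSets N 4).filter (fun W => (f ∈ W ∧ b' ∉ W) ∧ (e ∉ W ∧ b ∈ W ∧ ¬ (gr N \ W).erase b' ∈ biIndepSets N 4))).card +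
      ((biIndepSets N 4).filter (fun W => (f ∈ W ∧ b' ∉ W) ∧ (e ∈ W ∧ b ∉ W))).card +
      ((biIndepSets N 4).filter (fun W => (f ∈ W ∧ b' ∉ W) ∧ (e ∈ W ∧ b ∈ W ∧ (gr N \ W).erase b' ∈ biIndepSets N 4))).card +
      ((biIndepSets N 4).filter (fun W => (f ∈ W ∧ b' ∉ W) ∧ (e ∈ W ∧ b ∈ W ∧ ¬ (gr N \ W).erase b' ∈ biIndepSets N 4))).card ≤
      ((biIndepSets N 4).filter (fun W => f ∈ W ∧ b' ∉ W)).card := by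
    rw [← card_union_of_disjoint, ← card_union_of_disjoint, ← card_union_of_disjoint, ← card_union_of_disjoint]
    · apply card_le_card
      intro W hW
      simp only [mem_union, mem_filter] at hW ⊢
      rcases hW with (((hW | hW) | hW) | hW) | hW <;> exact ⟨hW.1, hW.2.1⟩
    · rw [disjoint_union_left, disjoint_union_left, disjoint_union_left]
      refine ⟨⟨⟨?_, ?_⟩, ?_⟩, ?_⟩ <;> rw [disjoint_filter]
      · rintro W _ ⟨-, heW, -⟩ ⟨-, heW', -, -⟩; exact heW heW'
      · rintro W _ ⟨-, heW, -, -⟩ ⟨-, heW', -, -⟩; exact heW heW'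
      · rintro W _ ⟨-, -, hbW⟩ ⟨-, -, hbW', -⟩; exact hbW hbW'
      · rintro W _ ⟨-, -, -, hc⟩ ⟨-, -, -, hc'⟩; exact hc' hc
    · rw [disjoint_union_left, disjoint_union_left]
      refine ⟨⟨?_, ?_⟩, ?_⟩ <;> rw [disjoint_filter]
      · rintro W _ ⟨-, heW, -⟩ ⟨-, heW', -, -⟩; exact heW heW'
      · rintro W _ ⟨-, heW, -, -⟩ ⟨-, heW', -, -⟩; exact heW heW'
      · rintro W _ ⟨-, -, hbW⟩ ⟨-, -, hbW', -⟩; exact hbW hbW'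
    · rw [disjoint_union_left]
      refine ⟨?_, ?_⟩ <;> rw [disjoint_filter]
      · rintro W _ ⟨-, heW, -⟩ ⟨-, heW', -⟩; exact heW heW'
      · rintro W _ ⟨-, heW, -, -⟩ ⟨-, heW', -⟩; exact heW heW'
    · rw [disjoint_filter]
      rintro W _ ⟨-, -, hc⟩ ⟨-, -, -, hc'⟩; exact hc' hc
  have hinj1 := card_off_demands_le (N := N) (b' := b') (e := e) hf hfb'
  have hs1 := card_filter_add_card_filter_not (s := d0DON N b' e f) (d0c1 N b e f)
  have hs2 := card_filter_add_card_filter_not (s := (d0DON N b' e f).filter (d0c1 N b e f)) (d0c2 N b b' e f)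
  have hs3 := card_filter_add_card_filter_not (s := (d0DON N b' e f).filter (fun W => ¬ d0c1 N b e f W)) (d0c3 N b b' e f)
  have hs4 := card_filter_add_card_filter_not
    (s := ((d0DON N b' e f).filter (fun W => ¬ d0c1 N b e f W)).filter (fun W => ¬ d0c3 N b b' e f W)) (d0c4 N b b' e f w₀)
  simp only [filter_filter] at hs2 hs3 hs4
  have hinjR1 := d0_injR1 hn hR hcf h he hf hef heb heb' hfb hfb' hE7 hnl he1 hf1 hef2 hX hH heH hfH hH3 hHon hHfl hw₀ hw₀H
  have hinjR3 := d0_injR3 hn hR hcf h he hf hef heb heb' hfb hfb' hE7 hnl he1 hf1 hef2 hX hH heH hfH hH3 hHon hHfl hw₀ hw₀H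
  have hinjR4b := d0_injR4b hn hR hcf h he hf hef heb heb' hfb hfb' hE7 hnl he1 hf1 hef2 hX hH heH hfH hH3 hHon hHfl hw₀ hw₀H
  have hinjR24 := d0_injR24 hn hR hcf h he hf hef heb heb' hfb hfb' hE7 hnl he1 hf1 hef2 hX hH heH hfH hH3 hHon hHfl hw₀ hw₀H
  have hDON : (d0DON N b' e f).card = ((biIndepSets N 4).filter (fun W => ((e ∈ W ∧ f ∉ W) ∧ b' ∉ W) ∧
      ¬ (gr N \ W).erase b' ∈ biIndepSets N 4)).card := rfl
  omega

end StarSharpD0I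

end PercRepro.Cogirth
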